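import Literature.Analysis.FluidPDE.GaussianVortexPlanarProofs
import Literature.Analysis.FluidPDE.BiotSavart2DSymmetry
import Literature.Analysis.Calculus.PlanarPolarIntegral
import Literature.Analysis.SpecialFunctions.PoissonKernelFourierCoefficients
import Mathlib.MeasureTheory.Integral.IntegralEqImproper
import Mathlib.Analysis.SpecialFunctions.Gaussian.FourierTransform
import HarnessLib

/-!
# The radial velocity of a mode-two planar vorticity

For the planar Biot–Savart law `v = K_{2D} ∗ w`, `K_{2D}(z) = z^⊥/(2π|z|²)`
(`Literature.Analysis.FluidPDE.biotSavart2D`, Gallay–Wayne 2006, (1.3)) and a vorticity in the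
second angular Fourier mode, `w(y) = y₀ y₁ a(|y|²)` (`= ½ r² a(r²) sin 2θ`), with a continuous
profile `a`, `|a(t)| ≤ C e^{−t/8}` (`t ≥ 0`), the radial component of the velocity is

  `⟪x, v(x)⟫ = (x₀² − x₁²) · ⅛ ( t⁻² ∫₀ᵗ u² a(u) du + ∫ₜ^∞ a(u) du )`,  `t = |x|²`

(`inner_self_biotSavart2D_modeTwo`). This is the formula `v_r = (2/r) Ω(r) cos 2θ` of
Gallay–Wayne 2006, §3 (display after (3.3)), with the stream coefficient `Ω` written out by the
Green's function of `−(rΩ')'/r + 4Ω/r²` ((3.4)) — the nonlocal half of the computation of `Λ w_∞`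
in the proof of their Proposition 3.1 (`Literature.Analysis.FluidPDE.GallayWayne2006_prop31`).
Proof: `⟪x, K_{2D}(x − y)⟫ = (x₀y₁ − x₁y₀)/(2π|x − y|²)`; polar coordinates and Fubini
(`Literature.Analysis.Calculus.integral_euclidean_eq_integral_Ioi_integral_Ioo_polar`); with
`x = r(cos α, sin α)` the angular integral is, after the shift `θ ↦ θ + α`,
`½ cos 2α ∫ sin 2θ sin θ/(r² + ρ² − 2rρ cos θ) dθ = ½ cos 2α · π min(r,ρ)/max(r,ρ)³` (the Poisson
moments of `Literature.Analysis.SpecialFunctions.PoissonKernelFourierCoefficients`; the `sin 2α`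
part is odd); the radial integral is split at `ρ = r` and `u = ρ²` substituted. Everything is
proved; no definitions, no named facts.

## References

* Th. Gallay, C. E. Wayne, *Existence and stability of asymmetric Burgers vortices*, J. Math.
  Fluid Mech. 9 (2007) 243–261 = arXiv:math/0503353, §3, (3.2)–(3.4), proof of Prop. 3.1.
  [GallayWayne2006]
-/

noncomputable section

open Set Function Filter MeasureTheory Metric Real
open scoped Topology RealInnerProductSpace

namespace Literature.Analysis.FluidPDE

/-! ### Elementary bounds -/

/-- `t e^{−t/c} ≤ c` for `t ≥ 0`, `c > 0`. [folklore] -/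
theorem mul_exp_neg_div_le {t c : ℝ} (ht : 0 ≤ t) (hc : 0 < c) : t * Real.exp (-(t / c)) ≤ c := by
  have h1 : t / c + 1 ≤ Real.exp (t / c) := Real.add_one_le_exp _
  have h2 : t ≤ c * Real.exp (t / c) := by
    have h3 : c * (t / c + 1) ≤ c * Real.exp (t / c) := mul_le_mul_of_nonneg_left h1 hc.le
    have h4 : c * (t / c + 1) = t + c := by field_simp
    linarith
  calc t * Real.exp (-(t / c)) ≤ c * Real.exp (t / c) * Real.exp (-(t / c)) := by gcongr
    _ = c := by rw [mul_assoc, ← Real.exp_add, add_neg_cancel, Real.exp_zero, mul_one]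

/-- `|y₀ y₁| ≤ |y|²`. [folklore] -/
theorem abs_mul_apply_le_norm_sq (y : EuclideanSpace ℝ (Fin 2)) : |y 0 * y 1| ≤ ‖y‖ ^ 2 := by
  rw [norm_sq_eq_two, abs_mul]
  nlinarith [sq_abs (y 0), sq_abs (y 1), abs_nonneg (y 0), abs_nonneg (y 1)]

section ModeTwo

variable {a : ℝ → ℝ} {C : ℝ} (ha : Continuous a)
  (hC : ∀ t, 0 ≤ t → |a t| ≤ C * Real.exp (-(t / 8)))
include hC

/-- **The mode-two vorticity `y₀y₁a(|y|²)` is bounded** by `8C`. [folklore] -/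
theorem abs_modeTwo_le (y : EuclideanSpace ℝ (Fin 2)) : |y 0 * y 1 * a (‖y‖ ^ 2)| ≤ 8 * C := by
  have hC0 : 0 ≤ C := by
    have h := hC 0 le_rfl
    simp only [zero_div, neg_zero, Real.exp_zero, mul_one] at h
    exact (abs_nonneg _).trans h
  have h1 := hC (‖y‖ ^ 2) (by positivity)
  rw [abs_mul]
  calc |y 0 * y 1| * |a (‖y‖ ^ 2)| ≤ ‖y‖ ^ 2 * (C * Real.exp (-(‖y‖ ^ 2 / 8))) := by
        gcongr
        exact abs_mul_apply_le_norm_sq y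
    _ = C * (‖y‖ ^ 2 * Real.exp (-(‖y‖ ^ 2 / 8))) := by ring
    _ ≤ C * 8 := by gcongr; exact mul_exp_neg_div_le (by positivity) (by norm_num)
    _ = 8 * C := by ring

/-- Gaussian domination: `|y₀y₁a(|y|²)| ≤ 16C e^{−|y|²/16}`. [folklore] -/
theorem abs_modeTwo_le_gaussian (y : EuclideanSpace ℝ (Fin 2)) :
    |y 0 * y 1 * a (‖y‖ ^ 2)| ≤ 16 * C * Real.exp (-(1 / 16) * ‖y‖ ^ 2) := by
  have hC0 : 0 ≤ C := by
    have h := hC 0 le_rfl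
    simp only [zero_div, neg_zero, Real.exp_zero, mul_one] at h
    exact (abs_nonneg _).trans h
  have h1 := hC (‖y‖ ^ 2) (by positivity)
  have hsplit : Real.exp (-(‖y‖ ^ 2 / 8)) =
      Real.exp (-(‖y‖ ^ 2 / 16)) * Real.exp (-(1 / 16) * ‖y‖ ^ 2) := by
    rw [← Real.exp_add]; ring_nf
  rw [abs_mul]
  calc |y 0 * y 1| * |a (‖y‖ ^ 2)| ≤ ‖y‖ ^ 2 * (C * Real.exp (-(‖y‖ ^ 2 / 8))) := by
        gcongr
        exact abs_mul_apply_le_norm_sq y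
    _ = C * (‖y‖ ^ 2 * Real.exp (-(‖y‖ ^ 2 / 16))) * Real.exp (-(1 / 16) * ‖y‖ ^ 2) := by
        rw [hsplit]; ring
    _ ≤ C * 16 * Real.exp (-(1 / 16) * ‖y‖ ^ 2) := by
        gcongr
        exact mul_exp_neg_div_le (by positivity) (by norm_num)
    _ = 16 * C * Real.exp (-(1 / 16) * ‖y‖ ^ 2) := by ring

include ha

omit hC in
/-- The mode-two vorticity is continuous. [folklore] -/
theorem continuous_modeTwo :
    Continuous fun y : EuclideanSpace ℝ (Fin 2) => y 0 * y 1 * a (‖y‖ ^ 2) := by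
  fun_prop

/-- **The mode-two vorticity is integrable.** [folklore] -/
theorem integrable_modeTwo :
    Integrable fun y : EuclideanSpace ℝ (Fin 2) => y 0 * y 1 * a (‖y‖ ^ 2) := by
  have hg : Integrable fun y : EuclideanSpace ℝ (Fin 2) =>
      16 * C * Real.exp (-(1 / 16) * ‖y‖ ^ 2) := by
    have h := (GaussianFourier.integrable_cexp_neg_mul_sq_norm_add
      (V := EuclideanSpace ℝ (Fin 2)) (b := 1 / 16) (by norm_num) 0 0).norm
    have hfun : (fun y : EuclideanSpace ℝ (Fin 2) => ‖Complex.exp (-(1 / 16 : ℂ) * (‖y‖ : ℂ) ^ 2 +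
        0 * (⟪(0 : EuclideanSpace ℝ (Fin 2)), y⟫ : ℂ))‖) =
        fun y => Real.exp (-(1 / 16) * ‖y‖ ^ 2) := by
      funext y
      rw [Complex.norm_exp]
      congr 1
      simp [pow_two, Complex.mul_re]
    rw [hfun] at h
    exact h.const_mul _
  refine hg.mono' (continuous_modeTwo ha).aestronglyMeasurable (Eventually.of_forall fun y => ?_)
  rw [Real.norm_eq_abs]
  exact abs_modeTwo_le_gaussian hC y

/-- The Biot–Savart integral of the mode-two vorticity converges absolutely. [folklore] -/
theorem integrable_modeTwo_smul_biotSavartKernel2D (x : EuclideanSpace ℝ (Fin 2)) :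
    Integrable fun y : EuclideanSpace ℝ (Fin 2) =>
      (y 0 * y 1 * a (‖y‖ ^ 2)) • biotSavartKernel2D (x - y) :=
  integrable_smul_biotSavartKernel2D (integrable_modeTwo ha hC) (abs_modeTwo_le hC) x

/-! ### The radial component as a scalar integral -/

omit ha hC in
/-- `⟪x, K_{2D}(x − y)⟫ = (x₀y₁ − x₁y₀)/(2π|x − y|²)`. [folklore] -/
theorem inner_self_biotSavartKernel2D_sub (x y : EuclideanSpace ℝ (Fin 2)) :
    ⟪x, biotSavartKernel2D (x - y)⟫ = (x 0 * y 1 - x 1 * y 0) / (2 * π * ‖x - y‖ ^ 2) := by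
  rw [biotSavartKernel2D, inner_smul_right, perp_sub, inner_sub_right, inner_perp_self_right,
    inner_fin_two, perp_apply_zero, perp_apply_one]
  ring

/-- **The radial velocity component as a scalar integral**:
`⟪x, (K_{2D} ∗ w)(x)⟫ = ∫ w(y) (x₀y₁ − x₁y₀)/(2π|x − y|²) dy`. [folklore] -/
theorem inner_self_biotSavart2D_modeTwo_eq_integral (x : EuclideanSpace ℝ (Fin 2)) :
    ⟪x, biotSavart2D (fun y : EuclideanSpace ℝ (Fin 2) => y 0 * y 1 * a (‖y‖ ^ 2)) x⟫ =
      ∫ y : EuclideanSpace ℝ (Fin 2), y 0 * y 1 * a (‖y‖ ^ 2) *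
        ((x 0 * y 1 - x 1 * y 0) / (2 * π * ‖x - y‖ ^ 2)) := by
  rw [biotSavart2D, ← integral_inner (𝕜 := ℝ) (integrable_modeTwo_smul_biotSavartKernel2D ha hC x)]
  refine integral_congr_ae (Eventually.of_forall fun y => ?_)
  simp only
  rw [inner_smul_right, inner_self_biotSavartKernel2D_sub]

/-- The scalar integrand is integrable. [folklore] -/
theorem integrable_modeTwo_mul_inner_kernel (x : EuclideanSpace ℝ (Fin 2)) :
    Integrable fun y : EuclideanSpace ℝ (Fin 2) => y 0 * y 1 * a (‖y‖ ^ 2) *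
      ((x 0 * y 1 - x 1 * y 0) / (2 * π * ‖x - y‖ ^ 2)) := by
  have h := (integrable_modeTwo_smul_biotSavartKernel2D ha hC x).const_inner (𝕜 := ℝ) x
  refine h.congr (Eventually.of_forall fun y => ?_)
  simp only
  rw [inner_smul_right, inner_self_biotSavartKernel2D_sub]

end ModeTwo

/-! ### The integrand in polar coordinates -/

/-- Components of a coordinate vector of the plane. [folklore] -/
@[simp] theorem toLp_fin_two_apply_zero (u v : ℝ) :
    (WithLp.toLp 2 ![u, v] : EuclideanSpace ℝ (Fin 2)) 0 = u := rfl

/-- Components of a coordinate vector of the plane. [folklore] -/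
@[simp] theorem toLp_fin_two_apply_one (u v : ℝ) :
    (WithLp.toLp 2 ![u, v] : EuclideanSpace ℝ (Fin 2)) 1 = v := rfl

/-- **The scalar integrand at a polar point.** With `x = (r cos α, r sin α)` and
`y = (ρ cos θ, ρ sin θ)`:
`ρ · [y₀y₁a(|y|²) (x₀y₁ − x₁y₀)/(2π|x − y|²)]
  = ρ⁴a(ρ²) r/(2π) · cos θ sin θ sin(θ − α)/(r² + ρ² − 2rρ cos(θ − α))`. [folklore] -/
theorem modeTwo_integrand_polar (a : ℝ → ℝ) {x : EuclideanSpace ℝ (Fin 2)} {r α : ℝ}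
    (hx0 : x 0 = r * cos α) (hx1 : x 1 = r * sin α) {ρ : ℝ} (hρ : 0 ≤ ρ) (θ : ℝ) :
    ρ • ((WithLp.toLp 2 ![ρ * cos θ, ρ * sin θ] : EuclideanSpace ℝ (Fin 2)) 0 *
        (WithLp.toLp 2 ![ρ * cos θ, ρ * sin θ] : EuclideanSpace ℝ (Fin 2)) 1 *
        a (‖(WithLp.toLp 2 ![ρ * cos θ, ρ * sin θ] : EuclideanSpace ℝ (Fin 2))‖ ^ 2) *
        ((x 0 * (WithLp.toLp 2 ![ρ * cos θ, ρ * sin θ] : EuclideanSpace ℝ (Fin 2)) 1 -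
          x 1 * (WithLp.toLp 2 ![ρ * cos θ, ρ * sin θ] : EuclideanSpace ℝ (Fin 2)) 0) /
          (2 * π * ‖x - WithLp.toLp 2 ![ρ * cos θ, ρ * sin θ]‖ ^ 2))) =
      ρ ^ 4 * a (ρ ^ 2) * r / (2 * π) *
        (cos θ * sin θ * sin (θ - α) / (r ^ 2 + ρ ^ 2 - 2 * r * ρ * cos (θ - α))) := by
  rw [Calculus.norm_toLp_polar hρ θ]
  simp only [smul_eq_mul, Matrix.cons_val_zero, Matrix.cons_val_one]
  have hD : ‖x - WithLp.toLp 2 ![ρ * cos θ, ρ * sin θ]‖ ^ 2 =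
      r ^ 2 + ρ ^ 2 - 2 * r * ρ * cos (θ - α) := by
    rw [norm_sq_eq_two, PiLp.sub_apply, PiLp.sub_apply, toLp_fin_two_apply_zero,
      toLp_fin_two_apply_one, hx0, hx1, cos_sub]
    nlinarith [sin_sq_add_cos_sq θ, sin_sq_add_cos_sq α]
  have hN : x 0 * (ρ * sin θ) - x 1 * (ρ * cos θ) = r * ρ * sin (θ - α) := by
    rw [hx0, hx1, sin_sub]; ring
  rw [hD, hN]
  generalize r ^ 2 + ρ ^ 2 - 2 * r * ρ * cos (θ - α) = D
  rw [div_mul_div_comm, mul_comm (2 * π) D]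
  ring

/-! ### The angular integral -/

/-- **The angular integral of the mode-two integrand**: after the shift `θ ↦ θ + α`,
`∫_{−π}^{π} cos θ sin θ sin(θ − α)/(r² + ρ² − 2rρ cos(θ − α)) dθ
  = ½ cos 2α ∫_{−π}^{π} sin 2θ sin θ/(r² + ρ² − 2rρ cos θ) dθ` (the `sin 2α` part is odd).
[folklore] -/
theorem integral_angular_modeTwo {r ρ : ℝ} (hr : 0 < r) (hρ : 0 ≤ ρ) (hne : ρ ≠ r) (α : ℝ) :
    ∫ θ in (-π)..π, cos θ * sin θ * sin (θ - α) / (r ^ 2 + ρ ^ 2 - 2 * r * ρ * cos (θ - α)) =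
      cos (2 * α) / 2 *
        ∫ θ in (-π)..π, sin (2 * θ) * sin θ / (r ^ 2 + ρ ^ 2 - 2 * r * ρ * cos θ) := by
  set k : ℝ → ℝ := fun θ => cos θ * sin θ * sin (θ - α) /
    (r ^ 2 + ρ ^ 2 - 2 * r * ρ * cos (θ - α)) with hk
  have hper : Function.Periodic k (2 * π) := by
    intro θ
    simp only [hk]
    rw [show θ + 2 * π - α = (θ - α) + 2 * π by ring, cos_add_two_pi, sin_add_two_pi,
      sin_add_two_pi, cos_add_two_pi]
  have hshift : ∫ θ in (-π)..π, k θ = ∫ θ in (-π)..π, k (θ + α) := by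
    rw [intervalIntegral.integral_comp_add_right k α]
    have h := hper.intervalIntegral_add_eq (-π + α) (-π)
    rw [show -π + α + 2 * π = π + α by ring, show -π + 2 * π = π by ring] at h
    exact h.symm
  have hexp : ∀ θ, k (θ + α) =
      cos (2 * α) / 2 * (sin (2 * θ) * sin θ / (r ^ 2 + ρ ^ 2 - 2 * r * ρ * cos θ)) +
      sin (2 * α) / 2 * (cos (2 * θ) * sin θ / (r ^ 2 + ρ ^ 2 - 2 * r * ρ * cos θ)) := by
    intro θ
    simp only [hk, add_sub_cancel_right]
    have h2 : cos (θ + α) * sin (θ + α) =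
        (sin (2 * θ) * cos (2 * α) + cos (2 * θ) * sin (2 * α)) / 2 := by
      rw [← sin_add, show 2 * θ + 2 * α = 2 * (θ + α) by ring, sin_two_mul]; ring
    generalize r ^ 2 + ρ ^ 2 - 2 * r * ρ * cos θ = D
    rw [show cos (θ + α) * sin (θ + α) * sin θ / D =
      (cos (θ + α) * sin (θ + α)) * (sin θ / D) by ring, h2]
    ring
  change ∫ θ in (-π)..π, k θ = _
  rw [hshift]
  simp only [hexp]
  have hD : ∀ θ, r ^ 2 + ρ ^ 2 - 2 * r * ρ * cos θ ≠ 0 := fun θ =>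
    (SpecialFunctions.sub_cos_den_pos hr hρ hne θ).ne'
  have hc1 : IntervalIntegrable
      (fun θ => sin (2 * θ) * sin θ / (r ^ 2 + ρ ^ 2 - 2 * r * ρ * cos θ)) volume (-π) π :=
    (Continuous.div (by fun_prop) (by fun_prop) hD).intervalIntegrable _ _
  have hc2 : IntervalIntegrable
      (fun θ => cos (2 * θ) * sin θ / (r ^ 2 + ρ ^ 2 - 2 * r * ρ * cos θ)) volume (-π) π :=
    (Continuous.div (by fun_prop) (by fun_prop) hD).intervalIntegrable _ _
  rw [intervalIntegral.integral_add (hc1.const_mul _) (hc2.const_mul _),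
    intervalIntegral.integral_const_mul, intervalIntegral.integral_const_mul,
    SpecialFunctions.integral_cos_two_mul_mul_sin_div_sub_cos, mul_zero, add_zero]

/-- **The inner (angular) integral in polar coordinates**, for `ρ > 0`, `ρ ≠ r = |x|`:
`(r² cos 2α)/4 · ρ⁵a(ρ²)/r⁴` for `ρ < r` and `(r² cos 2α)/4 · ρ a(ρ²)` for `ρ > r`. [folklore] -/
theorem setIntegral_Ioo_modeTwo_polar (a : ℝ → ℝ) {x : EuclideanSpace ℝ (Fin 2)} {r α : ℝ}
    (hr : 0 < r) (hx0 : x 0 = r * cos α) (hx1 : x 1 = r * sin α) {ρ : ℝ} (hρ : 0 < ρ)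
    (hne : ρ ≠ r) :
    ∫ θ in Ioo (-π) π, ρ • ((WithLp.toLp 2 ![ρ * cos θ, ρ * sin θ] : EuclideanSpace ℝ (Fin 2)) 0 *
        (WithLp.toLp 2 ![ρ * cos θ, ρ * sin θ] : EuclideanSpace ℝ (Fin 2)) 1 *
        a (‖(WithLp.toLp 2 ![ρ * cos θ, ρ * sin θ] : EuclideanSpace ℝ (Fin 2))‖ ^ 2) *
        ((x 0 * (WithLp.toLp 2 ![ρ * cos θ, ρ * sin θ] : EuclideanSpace ℝ (Fin 2)) 1 -
          x 1 * (WithLp.toLp 2 ![ρ * cos θ, ρ * sin θ] : EuclideanSpace ℝ (Fin 2)) 0) /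
          (2 * π * ‖x - WithLp.toLp 2 ![ρ * cos θ, ρ * sin θ]‖ ^ 2))) =
      r ^ 2 * cos (2 * α) / 4 *
        (if ρ < r then ρ ^ 5 * a (ρ ^ 2) / r ^ 4 else ρ * a (ρ ^ 2)) := by
  rw [setIntegral_congr_fun measurableSet_Ioo
    (fun θ _ => modeTwo_integrand_polar a hx0 hx1 hρ.le θ), integral_const_mul,
    ← integral_Ioc_eq_integral_Ioo,
    ← intervalIntegral.integral_of_le (by linarith [pi_pos] : -π ≤ π),
    integral_angular_modeTwo hr hρ.le hne α]
  by_cases h : ρ < r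
  · rw [if_pos h, SpecialFunctions.integral_sin_two_mul_mul_sin_div_sub_cos_of_lt hρ.le h]
    field_simp
    ring
  · have h' : r < ρ := lt_of_le_of_ne (not_lt.1 h) (Ne.symm hne)
    rw [if_neg h, SpecialFunctions.integral_sin_two_mul_mul_sin_div_sub_cos_of_gt hr.le h']
    field_simp
    ring

/-! ### The radial integral -/

section Radial

variable {a : ℝ → ℝ} {C : ℝ} (ha : Continuous a)
  (hC : ∀ t, 0 ≤ t → |a t| ≤ C * Real.exp (-(t / 8)))
include ha hC

/-- `ρ ↦ ρ a(ρ²)` is integrable on `[r, ∞)` for `r ≥ 0` (Gaussian domination). [folklore] -/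
theorem integrableOn_mul_comp_sq_Ici {r : ℝ} (hr : 0 ≤ r) :
    IntegrableOn (fun ρ => ρ * a (ρ ^ 2)) (Ici r) := by
  have hg : Integrable fun ρ : ℝ => C * (ρ * Real.exp (-(1 / 8) * ρ ^ 2)) :=
    (integrable_mul_exp_neg_mul_sq (by norm_num : (0 : ℝ) < 1 / 8)).const_mul C
  refine (hg.integrableOn (s := Ici r)).mono'
    (by fun_prop : Continuous fun ρ : ℝ => ρ * a (ρ ^ 2)).aestronglyMeasurable.restrict
    ((ae_restrict_iff' measurableSet_Ici).2 (Eventually.of_forall fun ρ hρ => ?_))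
  have hρ0 : 0 ≤ ρ := hr.trans hρ
  have h := hC (ρ ^ 2) (by positivity)
  rw [norm_mul, Real.norm_eq_abs, Real.norm_eq_abs, abs_of_nonneg hρ0]
  calc ρ * |a (ρ ^ 2)| ≤ ρ * (C * Real.exp (-(ρ ^ 2 / 8))) := by gcongr
    _ = C * (ρ * Real.exp (-(1 / 8) * ρ ^ 2)) := by ring_nf

/-- `a` is integrable on `[s, ∞)` for `s ≥ 0`. [folklore] -/
theorem integrableOn_profile_Ici {s : ℝ} (hs : 0 ≤ s) : IntegrableOn a (Ici s) := by
  rw [integrableOn_Ici_iff_integrableOn_Ioi]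
  have hg : IntegrableOn (fun u : ℝ => C * Real.exp (-(1 / 8) * u)) (Ioi s) :=
    (exp_neg_integrableOn_Ioi s (by norm_num : (0 : ℝ) < 1 / 8)).const_mul C
  refine hg.mono' ha.aestronglyMeasurable.restrict
    ((ae_restrict_iff' measurableSet_Ioi).2 (Eventually.of_forall fun u hu => ?_))
  have hu0 : 0 ≤ u := hs.trans (le_of_lt (mem_Ioi.1 hu))
  rw [Real.norm_eq_abs]
  calc |a u| ≤ C * Real.exp (-(u / 8)) := hC u hu0
    _ = C * Real.exp (-(1 / 8) * u) := by ring_nf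

/-- The substitution `u = ρ²` on `(r, ∞)`: `∫_r^∞ ρ a(ρ²) dρ = ½ ∫_{r²}^∞ a(u) du`. [folklore] -/
theorem integral_Ioi_mul_comp_sq {r : ℝ} (hr : 0 ≤ r) :
    ∫ ρ in Ioi r, ρ * a (ρ ^ 2) = (1 / 2) * ∫ u in Ioi (r ^ 2), a u := by
  have h := integral_comp_mul_deriv_Ioi (f := fun ρ : ℝ => ρ ^ 2) (f' := fun ρ => 2 * ρ)
    (g := fun u => (1 / 2) * a u) (a := r) (by fun_prop) (tendsto_pow_atTop two_ne_zero)
    (fun ρ _ => by simpa using (hasDerivAt_pow 2 ρ).hasDerivWithinAt)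
    ((continuous_const.mul ha).continuousOn) ?_ ?_
  · rw [integral_const_mul] at h
    rw [← h]
    refine setIntegral_congr_fun measurableSet_Ioi fun ρ _ => ?_
    simp only [comp_apply]
    ring
  · refine IntegrableOn.mono_set
      ((integrableOn_profile_Ici ha hC (sq_nonneg r)).const_mul (1 / 2)) ?_
    rintro _ ⟨ρ, hρ, rfl⟩
    exact pow_le_pow_left₀ hr hρ 2
  · refine (integrableOn_mul_comp_sq_Ici ha hC hr).congr_fun (fun ρ _ => ?_) measurableSet_Ici
    simp only [comp_apply]
    ring

omit hC in
/-- The substitution `u = ρ²` on `(0, r)`: `∫₀^r ρ⁵ a(ρ²) dρ = ½ ∫₀^{r²} u² a(u) du`. [folklore] -/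
theorem integral_pow_five_mul_comp_sq (r : ℝ) :
    ∫ ρ in (0 : ℝ)..r, ρ ^ 5 * a (ρ ^ 2) = (1 / 2) * ∫ u in (0 : ℝ)..r ^ 2, u ^ 2 * a u := by
  have h := intervalIntegral.integral_comp_mul_deriv (a := 0) (b := r) (f := fun ρ : ℝ => ρ ^ 2)
    (f' := fun ρ => 2 * ρ) (g := fun u => (1 / 2) * (u ^ 2 * a u))
    (fun ρ _ => by simpa using hasDerivAt_pow 2 ρ) (by fun_prop) (by fun_prop)
  simp only [comp_apply] at h
  rw [intervalIntegral.integral_const_mul, show ((0 : ℝ) ^ 2) = 0 by norm_num] at h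
  rw [← h]
  refine intervalIntegral.integral_congr fun ρ _ => ?_
  ring

/-- **The radial integral**:
`∫_{ρ>0} [ρ<r: ρ⁵a(ρ²)/r⁴ ; ρ>r: ρ a(ρ²)] dρ = ½ r⁻⁴ ∫₀^{r²} u²a + ½ ∫_{r²}^∞ a`. [folklore] -/
theorem integral_Ioi_radial_modeTwo {r : ℝ} (hr : 0 < r) :
    ∫ ρ in Ioi (0 : ℝ), (if ρ < r then ρ ^ 5 * a (ρ ^ 2) / r ^ 4 else ρ * a (ρ ^ 2)) =
      (1 / 2) * ((r ^ 4)⁻¹ * ∫ u in (0 : ℝ)..r ^ 2, u ^ 2 * a u) +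
        (1 / 2) * ∫ u in Ioi (r ^ 2), a u := by
  set P : ℝ → ℝ := fun ρ => if ρ < r then ρ ^ 5 * a (ρ ^ 2) / r ^ 4 else ρ * a (ρ ^ 2) with hP
  have hcont : Continuous fun ρ : ℝ => ρ ^ 5 * a (ρ ^ 2) / r ^ 4 := by fun_prop
  -- the two pieces
  have h1 : IntegrableOn P (Ioc 0 r) := by
    rw [integrableOn_Ioc_iff_integrableOn_Ioo]
    refine ((hcont.integrableOn_Icc (a := 0) (b := r)).mono_set Ioo_subset_Icc_self).congr_fun
      (fun ρ hρ => ?_) measurableSet_Ioo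
    simp only [hP, if_pos hρ.2]
  have h2 : IntegrableOn P (Ioi r) := by
    refine ((integrableOn_mul_comp_sq_Ici ha hC hr.le).mono_set Ioi_subset_Ici_self).congr_fun
      (fun ρ hρ => ?_) measurableSet_Ioi
    simp only [hP, if_neg (not_lt.2 (le_of_lt (mem_Ioi.1 hρ)))]
  have hsplit : ∫ ρ in Ioi (0 : ℝ), P ρ = (∫ ρ in Ioc 0 r, P ρ) + ∫ ρ in Ioi r, P ρ := by
    rw [← Ioc_union_Ioi_eq_Ioi hr.le,
      setIntegral_union Ioc_disjoint_Ioi_same measurableSet_Ioi h1 h2]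
  have hI1 : ∫ ρ in Ioc 0 r, P ρ = (r ^ 4)⁻¹ * ((1 / 2) * ∫ u in (0 : ℝ)..r ^ 2, u ^ 2 * a u) := by
    rw [integral_Ioc_eq_integral_Ioo, setIntegral_congr_fun measurableSet_Ioo
      (fun ρ hρ => by simp only [hP, if_pos hρ.2] : ∀ ρ ∈ Ioo 0 r, P ρ = ρ ^ 5 * a (ρ ^ 2) / r ^ 4),
      ← integral_Ioc_eq_integral_Ioo, ← intervalIntegral.integral_of_le hr.le,
      ← integral_pow_five_mul_comp_sq ha r, ← intervalIntegral.integral_const_mul]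
    refine intervalIntegral.integral_congr fun ρ _ => ?_
    ring
  have hI2 : ∫ ρ in Ioi r, P ρ = (1 / 2) * ∫ u in Ioi (r ^ 2), a u := by
    rw [setIntegral_congr_fun measurableSet_Ioi
      (fun ρ hρ => by simp only [hP, if_neg (not_lt.2 (le_of_lt (mem_Ioi.1 hρ)))] :
        ∀ ρ ∈ Ioi r, P ρ = ρ * a (ρ ^ 2)), integral_Ioi_mul_comp_sq ha hC hr.le]
  change ∫ ρ in Ioi (0 : ℝ), P ρ = _
  rw [hsplit, hI1, hI2]
  ring

/-! ### The radial velocity component -/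

/-- **The radial velocity component of a mode-two vorticity** (Gallay–Wayne 2006, §3, the
formula `v_r = (2/r)Ω(r) cos 2θ` with `Ω` from (3.4), written out): for `w(y) = y₀y₁a(|y|²)`
with continuous `a`, `|a(t)| ≤ Ce^{−t/8}`,
`⟪x, (K_{2D} ∗ w)(x)⟫ = (x₀² − x₁²) · ⅛ (t⁻²∫₀ᵗ u²a(u) du + ∫ₜ^∞ a(u) du)`, `t = |x|²`.
[cite: GallayWayne2006, §3 (3.2)–(3.4)] -/
theorem inner_self_biotSavart2D_modeTwo (x : EuclideanSpace ℝ (Fin 2)) :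
    ⟪x, biotSavart2D (fun y : EuclideanSpace ℝ (Fin 2) => y 0 * y 1 * a (‖y‖ ^ 2)) x⟫ =
      (x 0 ^ 2 - x 1 ^ 2) * ((1 / 8) * (((‖x‖ ^ 2) ^ 2)⁻¹ * (∫ u in (0 : ℝ)..‖x‖ ^ 2, u ^ 2 * a u) +
        ∫ u in Ioi (‖x‖ ^ 2), a u)) := by
  by_cases hx : x = 0
  · subst hx
    simp
  obtain ⟨α, hx0, hx1⟩ := Calculus.exists_apply_eq_norm_mul_cos_sin x
  set r := ‖x‖ with hr_def
  have hr : 0 < r := norm_pos_iff.2 hx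
  have hcos : x 0 ^ 2 - x 1 ^ 2 = r ^ 2 * cos (2 * α) := by
    rw [hx0, hx1, cos_two_mul]
    nlinarith [sin_sq_add_cos_sq α]
  rw [inner_self_biotSavart2D_modeTwo_eq_integral ha hC x,
    Calculus.integral_euclidean_eq_integral_Ioi_integral_Ioo_polar
      (integrable_modeTwo_mul_inner_kernel ha hC x)]
  have hae : ∀ᵐ ρ ∂(volume : Measure ℝ), ρ ∈ Ioi (0 : ℝ) →
      (∫ θ in Ioo (-π) π, ρ • ((fun y : EuclideanSpace ℝ (Fin 2) => y 0 * y 1 * a (‖y‖ ^ 2) *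
        ((x 0 * y 1 - x 1 * y 0) / (2 * π * ‖x - y‖ ^ 2)))
          (WithLp.toLp 2 ![ρ * cos θ, ρ * sin θ]))) =
        r ^ 2 * cos (2 * α) / 4 *
          (if ρ < r then ρ ^ 5 * a (ρ ^ 2) / r ^ 4 else ρ * a (ρ ^ 2)) := by
    have hne : ∀ᵐ ρ ∂(volume : Measure ℝ), ρ ≠ r := by
      have h0 : (volume : Measure ℝ) {r} = 0 := measure_singleton r
      exact (measure_eq_zero_iff_ae_notMem.1 h0).mono fun ρ h => by simpa using h
    filter_upwards [hne] with ρ hρr hρ0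
    exact setIntegral_Ioo_modeTwo_polar a hr hx0 hx1 hρ0 hρr
  rw [setIntegral_congr_ae measurableSet_Ioi hae, integral_const_mul,
    integral_Ioi_radial_modeTwo ha hC hr, hcos]
  ring

end Radial

end Literature.Analysis.FluidPDE
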